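import Literature.Barriers.ValiantsHypothesis.AlgebraicNaturalProofsKRSTVNP
import Literature.Computability.AlgebraicComplexity.PermanentMonotone
import HarnessLib

/-!
# Algebraically natural proofs: KRST 2022, Main Theorem in its PRINTED quantifier form
# ("infinitely often from infinitely often"), PROVED

Sequel of `AlgebraicNaturalProofsKRSTVNP.lean`, whose `succinctHittingSetsFromVNP_of_permanentExpHard`
is the "almost-everywhere from almost-everywhere" variant (hypothesis `2^j ≤ L(per_{j^c})` for ALL
large `j`, conclusion for ALL large `n`). Print (Kumar–Ramya–Saptharishi–Tengse 2022, Thm. MainThm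
with the concluding note of §3.5) assumes hardness INFINITELY OFTEN — "`Perm_m` requires size
`2^{m^ε}` for infinitely many `m`" — and concludes that the `VNP`-succinct class hits the level-`a`
distinguishers for infinitely many `n`. This file proves that form:

* `PermanentExpHardIO F c` — `∀ m₀, ∃ j ≥ m₀, 2^j ≤ L(per_{j^c})` (`ε = 1/c`).
* `succinctHittingSetsFromVNP_io_of_permanentExpHardIO` —
  `PermanentExpHardIO F c → ∃ b, ∀ a n₀, ∃ n ≥ n₀,
  IsSuccinctHittingSet (degLEMonomials n) (SmallDefinable F n b) (Distinguishers F n a)`,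
  unconditionally (characteristic zero). Along a hard index `j` one takes `n = ⌈j^{1/3}⌉`: then
  `M = n^{3c} ≥ j^c`, so `L(per_M) ≥ L(per_{j^c}) ≥ 2^j` by the monotonicity of the permanent
  family (`complexity_perPoly_mono`, `PermanentMonotone.lean`), while the Kabanets–Impagliazzo bound
  `kiBound a c n ≤ 2^{7(E(n)+1)}` is `< 2^{(n-1)^3} ≤ 2^j` for large `n` (`kiBound_exponent_lt_pred_cube`).
* `not_exists_isNaturalProof_smallDefinable_io` — the natural-proofs reading (FSV Thm. 4).

WHAT THIS IS NOT: nothing about `VP`-succinctness (see `AlgebraicNaturalProofsKRST.lean`).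

## References

* [KumarRamyaSaptharishiTengse2022] M. Kumar, C. Ramya, R. Saptharishi, A. Tengse, *If VNP is
  hard, then so are equations for it*, STACS 2022, Thm. MainThm and §3.5 (concluding note on
  "infinitely often").
-/

noncomputable section

namespace Literature.Barriers.ValiantsHypothesis

open Literature.Computability.AlgebraicComplexity Literature.Computability.MetaComplexity
  MvPolynomial

section IO

/-- **Exponential hardness of the permanent, infinitely often** (the printed hypothesis of KRST's
Main Theorem, `ε = 1/c`): for every `m₀` there is `j ≥ m₀` with `2^j ≤ L(per_{j^c})`.
[cite: KumarRamyaSaptharishiTengse2022, Thm. MainThm (hypothesis)] -/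
def PermanentExpHardIO (F : Type*) [CommSemiring F] (c : ℕ) : Prop :=
  ∀ m₀ : ℕ, ∃ j : ℕ, m₀ ≤ j ∧ 2 ^ j ≤ complexity (perPoly (Fin (j ^ c)) F)

/-- The almost-everywhere hypothesis implies the infinitely-often one.
[cite: KumarRamyaSaptharishiTengse2022, §3.5] -/
theorem PermanentExpHardWith.io {F : Type*} [CommSemiring F] {c m₀ : ℕ}
    (h : PermanentExpHardWith F c m₀) : PermanentExpHardIO F c :=
  fun m => ⟨max m m₀, le_max_left _ _, h _ (le_max_right _ _)⟩

/-- Arithmetic: the exponent `7 (E(k+1) + 1)` of `kiBound_le_two_pow` at `n = k + 1` is at most `k³`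
for `k ≥ 14 (2a + 6c + 6) + 7`. [cite: KumarRamyaSaptharishiTengse2022, §3.5] -/
theorem kiBound_exponent_le_pred_cube (a c k : ℕ) (hk : 14 * (2 * a + 6 * c + 6) + 7 ≤ k) :
    7 * ((2 * a * (k + 1) + (k + 1) ^ 2 + 3 * c * (k + 1) ^ 2 + (k + 1) + 3 * c * (k + 1) + 4) + 1) ≤
      k ^ 3 := by
  set K := 2 * a + 6 * c + 6 with hK
  have hk1 : 1 ≤ k + 1 := by omega
  have hn2 : k + 1 ≤ (k + 1) ^ 2 := by rw [sq]; exact Nat.le_mul_of_pos_right _ hk1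
  have hE : 2 * a * (k + 1) + (k + 1) ^ 2 + 3 * c * (k + 1) ^ 2 + (k + 1) + 3 * c * (k + 1) + 4 ≤
      K * (k + 1) ^ 2 := by
    have h1 : 2 * a * (k + 1) ≤ 2 * a * (k + 1) ^ 2 := Nat.mul_le_mul_left _ hn2
    have h3 : 3 * c * (k + 1) ≤ 3 * c * (k + 1) ^ 2 := Nat.mul_le_mul_left _ hn2
    have h4 : 4 ≤ 4 * (k + 1) ^ 2 := Nat.le_mul_of_pos_right 4 (by positivity)
    calc 2 * a * (k + 1) + (k + 1) ^ 2 + 3 * c * (k + 1) ^ 2 + (k + 1) + 3 * c * (k + 1) + 4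
        ≤ 2 * a * (k + 1) ^ 2 + (k + 1) ^ 2 + 3 * c * (k + 1) ^ 2 + (k + 1) ^ 2 +
            3 * c * (k + 1) ^ 2 + 4 * (k + 1) ^ 2 := by gcongr
      _ = K * (k + 1) ^ 2 := by rw [hK]; ring
  have hsq : (k + 1) ^ 2 ≤ 2 * k ^ 2 := by nlinarith
  have hk3 : 3 ≤ k := by omega
  calc 7 * ((2 * a * (k + 1) + (k + 1) ^ 2 + 3 * c * (k + 1) ^ 2 + (k + 1) + 3 * c * (k + 1) + 4) + 1)
      ≤ 7 * (K * (k + 1) ^ 2 + 1) := by gcongr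
    _ ≤ 7 * (K * (2 * k ^ 2) + k ^ 2) := by gcongr; nlinarith
    _ = (14 * K + 7) * k ^ 2 := by ring
    _ ≤ k * k ^ 2 := Nat.mul_le_mul_right _ (by omega)
    _ = k ^ 3 := by ring

variable {F : Type*} [Field F]

/-- **Along a hard index the KI bound is beaten**: if `2^j ≤ L(per_{j^c})` with `j` large, then at
`n = ⌈j^{1/3}⌉` (the least `n` with `j ≤ n³`) one has `n ≥ N` whenever `j ≥ N³`, and
`kiBound a c n < L(per_{n^{3c}})` (monotonicity of the permanent family for the hardness side,
`kiBound_le_two_pow` and `(n-1)³ < j` for the other). [cite: KumarRamyaSaptharishiTengse2022, §3.5] -/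
theorem exists_kiBound_lt_of_hard_index (a c N : ℕ) (hN : 14 * (2 * a + 6 * c + 6) + 8 ≤ N) {j : ℕ}
    (hjN : N ^ 3 ≤ j) (hj : 2 ^ j ≤ complexity (perPoly (Fin (j ^ c)) F)) :
    ∃ n : ℕ, N ≤ n ∧ kiBound a c n < complexity (perPoly (Fin (krstBlock c n)) F) := by
  classical
  have hex : ∃ n : ℕ, j ≤ n ^ 3 := ⟨j, Nat.le_self_pow (by norm_num) j⟩
  set n := Nat.find hex with hn
  have hjn : j ≤ n ^ 3 := Nat.find_spec hex
  have hNn : N ≤ n := by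
    by_contra hlt
    push Not at hlt
    have : n ^ 3 < N ^ 3 := Nat.pow_lt_pow_left hlt (by norm_num)
    omega
  have hn1 : 1 ≤ n := le_trans (by omega) hNn
  -- minimality: `(n-1)³ < j`
  obtain ⟨k, hk⟩ : ∃ k, n = k + 1 := ⟨n - 1, by omega⟩
  have hkj : k ^ 3 < j := by
    have := Nat.find_min hex (show k < Nat.find hex by omega)
    omega
  refine ⟨n, hNn, ?_⟩
  -- hardness side
  have hM : j ^ c ≤ krstBlock c n := by
    unfold krstBlock; rw [pow_mul]; exact Nat.pow_le_pow_left hjn c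
  have hhard : 2 ^ j ≤ complexity (perPoly (Fin (krstBlock c n)) F) :=
    hj.trans (complexity_perPoly_mono F hM)
  -- KI side
  refine lt_of_lt_of_le ?_ hhard
  refine lt_of_le_of_lt (kiBound_le_two_pow a c n) (Nat.pow_lt_pow_right (by norm_num) ?_)
  have hexp := kiBound_exponent_le_pred_cube a c k (by omega)
  rw [hk]
  omega

variable [CharZero F]

/-- **Kumar–Ramya–Saptharishi–Tengse 2022, Main Theorem, printed ("infinitely often") form —
PROVED, no named-fact hypothesis.** Over a field of characteristic zero, if the permanent is
`2^{m^{1/c}}`-hard for infinitely many `m` of the form `j^c` (`PermanentExpHardIO F c`), then there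
is ONE exponent `b` such that for every distinguisher level `a` and INFINITELY MANY `n`, the
coefficient vectors of the `VNP`-succinct class `SmallDefinable F n b` hit every nonzero polynomial
of size and degree `≤ N^a` in the `N = binom(2n,n)` coefficient variables.
[cite: KumarRamyaSaptharishiTengse2022, Thm. MainThm] -/
theorem succinctHittingSetsFromVNP_io_of_permanentExpHardIO {c : ℕ} (hper : PermanentExpHardIO F c) :
    ∃ b : ℕ, ∀ a n₀ : ℕ, ∃ n : ℕ, n₀ ≤ n ∧
      IsSuccinctHittingSet (degLEMonomials n) (SmallDefinable F n b) (Distinguishers F n a) := by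
  obtain ⟨b, N₁, hsucc⟩ := krstSuccinctIn_smallDefinable (F := F) c
  refine ⟨b, fun a n₀ => ?_⟩
  set N := max (max n₀ N₁) (14 * (2 * a + 6 * c + 6) + 8) with hNdef
  obtain ⟨j, hjN, hj⟩ := hper (N ^ 3)
  obtain ⟨n, hNn, hki⟩ := exists_kiBound_lt_of_hard_index (F := F) a c N (le_max_right _ _) hjN hj
  have hn₀ : n₀ ≤ n := le_trans ((le_max_left _ _).trans (le_max_left _ _)) hNn
  have hN₁ : N₁ ≤ n := le_trans ((le_max_right _ _).trans (le_max_left _ _)) hNn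
  exact ⟨n, hn₀, isSuccinctHittingSet_of_permanent_hard (lt_krstPrime c n)
    (krstBlock_sq_le_krstPrime c n) hki (hsucc n hN₁)⟩

/-- Hence (FSV Thm. 4): under infinitely-often hardness, for every level `a` there are infinitely
many `n` at which NO level-`a` natural proof against the `VNP`-succinct class exists.
[cite: KumarRamyaSaptharishiTengse2022, Thm. MainThm] -/
theorem not_exists_isNaturalProof_smallDefinable_io {c : ℕ} (hper : PermanentExpHardIO F c) :
    ∃ b : ℕ, ∀ a n₀ : ℕ, ∃ n : ℕ, n₀ ≤ n ∧
      ¬ ∃ D, IsNaturalProof (degLEMonomials n) (SmallDefinable F n b) (Distinguishers F n a) D := by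
  obtain ⟨b, hb⟩ := succinctHittingSetsFromVNP_io_of_permanentExpHardIO hper
  refine ⟨b, fun a n₀ => ?_⟩
  obtain ⟨n, hn, h⟩ := hb a n₀
  refine ⟨n, hn, ?_⟩
  rw [exists_isNaturalProof_iff, not_not]
  exact h

end IO

end Literature.Barriers.ValiantsHypothesis

end
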